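import Literature.IUT.HodgeTheaters.InitialThetaDataPlaces
import Literature.IUT.HodgeTheaters.PMBaseKitModel
import Mathlib.CategoryTheory.Equivalence
import HarnessLib

/-!
# The TRUNCATED place-kit bridge `InitialThetaData → PMBaseKit` (merge canon C9-d, RULING D13 (α))

Mochizuki, *Inter-universal Teichmüller Theory I*, kurims manuscript (May 2020), Def 3.1 (b), (e)
pp.61–62, Def 4.1 (i) p.95, Def 6.1 pp.155–159 [cite: Mochizuki2012, I Def 3.1 (e) p.62, Def 6.1 p.155]
(D-0012 claim key, status disputed; BRIDGE between two landed typings — nothing of the series is asserted).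

**RECORDED WEAKENING (HISTORICAL since B11): the field `PMBaseKit.fintypeV` of the kit as frozen at p405271 FORCED truncation
to finite `S`; print's `V̲` is infinite (`isEmpty_fintype_V`, p408766). B11 (p414335, 2026-08-26) DELETED that unused field;
since then the un-truncated (β) bridge of record is abc-iut-L5-t4's `InitialThetaData.PlaceKit` (`PlaceKitBridge.lean`), of
which every truncated kit below is a restriction (`PlaceKit.restrict`, `PlaceKitTruncation.lean`). This (α) family stays the
reading for decls that genuinely need a finite index set.**

Print indexes prime-strips, bridges and Hodge theaters by the set `V̲` of [IUTchI] Def 3.1 (e) ("`V̲ ⊆ V(K)` is a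
subset that induces a natural bijection `V̲ ⥲ V_mod`"), which is INFINITE (`V_mod = V(F_mod)`, all valuations of a
number field): abc-iut-L5-t2's REAL definition `InitialThetaData` + `InitialThetaData.isEmpty_fintype_V`
(`InitialThetaDataPlaces.lean`). abc-iut-L5-t4's [IUTchI] §5–§6 kit `PMBaseKit l` (`PMBaseKit.lean`), over which
the L5/L6/c312 typings of `𝒟`- and `ℱ`-prime-strips, Θ^±/Θ^ell-bridges and Θ^{±ell}-Hodge theaters are written, carried
(until B11, p414335) a field `[fintypeV : Fintype V]`, so that no `PMBaseKit`-instance with `V := ↥D.V` existed. The cell's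
merge canon (plan/L6/MERGE-MAP.md §4 C9-d; L6-lead RULING D13 2026-08-25T22:03:58Z, L5-lead 22:11:27Z/22:11:48Z) therefore
adopted, until the Fintype-free revision of the kit (bridge debt B11, now DONE), the FAMILY OF TRUNCATED BRIDGES
`S ↦ kit(V̲_S)` over the finite truncations `V̲_S := {v̲ ∈ V̲ | v ∈ S}` (`InitialThetaData.VOver`, `fintypeVOver`)
for finite `S ⊆ V_mod` containing `V^bad_mod`, the archimedean places, and whole fibres over `V(ℚ)`
(`IsAdmissibleTruncation`), and READS every decl quantified over a `[Fintype V]`-kit «for every admissible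
finite truncation `S` of `V̲`».

This file types exactly that bridge, as a HYPOTHESIS STRUCTURE (FACT policy: the real kit at `V̲_S` — tempered
/ étale fundamental groups, Aut-holomorphic orbispaces — is the merge of layers L3/L4/L5 and is not constructed
here): `InitialThetaData.TruncatedKit D S` = a kit `PMBaseKit l` whose index type IS `V̲_S` (an `Equiv`
carrying `bad ↦ V̲^bad`, `arc ↦ V̲^arc`), a restriction law `TruncatedKit.Restriction` along `S ⊆ S′` (index
embedding over `V̲`, ambient categories and models identified), and — KIT-RULE non-vacuity — an inhabitant of
both over abc-iut-L5-t4's toy kit (`PMBaseKit.reindex`, `TruncatedKit.toy`, `Restriction.toy`). What the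
truncation loses and for which decls: MERGE-MAP §4 D13 (only definitions whose content ranges over all of `V̲`
at once; as of D13 none of the landed PMBase*/FPrimeStrips* decls does — which is why B11 could delete the field).
v3 (2026-08-26): prose updated after B11; `PMBaseKit.reindex_bad` / `reindex_arc` added (in-tree `rfl` witnesses that this
module is built against the current `PMBaseKit`); all other declarations byte-identical to v2 (p411826).
-/

namespace Literature.IUT.HodgeTheaters

open CategoryTheory

universe uK u v w

namespace PMBaseKit

variable {l : ℕ}

/-- **IUTchI:Def6.1** (kurims p.156) **Re-indexing a base kit.** Every per-valuation field of abc-iut-L5-t4's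
`PMBaseKit` (ambient category `Amb v`, model `𝒟_v`, `†𝒟_v^±`, `LabCusp^±`, its `𝔽_l^±`-group structure, the
restriction functor `Glob ⥤ Amb v`, `φ^{Θell}_{•,v}`, …) is a datum AT `v`, and the global fields do not mention
`V`; hence a kit indexed by `V` and a map `f : W → V` from a finite index type give a kit indexed by `W` with
`Amb w := Amb (f w)` etc. and freely prescribed `W^bad`, `W^arc` (no field of the kit constrains them). Used
below to inhabit truncated kits over the toy kit. [claim: Mochizuki2012, status: disputed] -/
def reindex (K : PMBaseKit.{uK} l) (W : Type) [Fintype W] [DecidableEq W] (f : W → K.V)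
    (bad arc : Finset W) : PMBaseKit.{uK} l where
  V := W
  bad := bad
  arc := arc
  Amb w := K.Amb (f w)
  model w := K.model (f w)
  pmObj w := K.pmObj (f w)
  toPM w := K.toPM (f w)
  LabCuspPM w := K.LabCuspPM (f w)
  labPM w := K.labPM (f w)
  labMap w := K.labMap (f w)
  labMap_refl w := K.labMap_refl (f w)
  labMap_trans w := K.labMap_trans (f w)
  labMap_charts w := K.labMap_charts (f w)
  exists_negative w := K.exists_negative (f w)
  Glob := K.Glob
  gModel := K.gModel
  gIso := K.gIso
  GLab := K.GLab
  gLabMap := K.gLabMap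
  gLabMap_refl := K.gLabMap_refl
  gLabMap_trans := K.gLabMap_trans
  toFlStar := K.toFlStar
  toFlStar_surjective := K.toFlStar_surjective
  gLabT := K.gLabT
  gChart₀ := K.gChart₀
  gChart₀_mem := K.gChart₀_mem
  autCsp_le := K.autCsp_le
  gLab_range := K.gLab_range
  atV w := K.atV (f w)
  phiEll w := K.phiEll (f w)
  labOfHom w := K.labOfHom (f w)
  labOfHom_pre w := K.labOfHom_pre (f w)
  labOfHom_post w := K.labOfHom_post (f w)
  labOfHom_phiEll_bijective w := K.labOfHom_phiEll_bijective (f w)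
  labOfHom_phiEll_charts w := K.labOfHom_phiEll_charts (f w)

/-- **IUTchI:Def6.1** (kurims p.156) The ambient category of the re-indexed kit at `w` IS that of the kit at `f w`.
[claim: Mochizuki2012, status: disputed] -/
theorem reindex_Amb (K : PMBaseKit.{uK} l) (W : Type) [Fintype W] [DecidableEq W] (f : W → K.V)
    (bad arc : Finset W) (w : W) : (K.reindex W f bad arc).Amb w = K.Amb (f w) := rfl

/-- **IUTchI:Def6.1** (kurims p.156) The model of the re-indexed kit at `w` IS the model at `f w`.
[claim: Mochizuki2012, status: disputed] -/
theorem reindex_model (K : PMBaseKit.{uK} l) (W : Type) [Fintype W] [DecidableEq W] (f : W → K.V)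
    (bad arc : Finset W) (w : W) : (K.reindex W f bad arc).model w = K.model (f w) := rfl

/-- **IUTchI:Def6.1** (kurims p.156) The bad index set of the re-indexed kit is the prescribed one (v3: in-tree `rfl` witness
that this module is built against the current, Fintype-free `PMBaseKit`). [claim: Mochizuki2012, status: disputed] -/
theorem reindex_bad (K : PMBaseKit.{uK} l) (W : Type) [Fintype W] [DecidableEq W] (f : W → K.V)
    (bad arc : Finset W) : (K.reindex W f bad arc).bad = bad := rfl

/-- **IUTchI:Def6.1** (kurims p.156) The archimedean index set of the re-indexed kit is the prescribed one.
[claim: Mochizuki2012, status: disputed] -/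
theorem reindex_arc (K : PMBaseKit.{uK} l) (W : Type) [Fintype W] [DecidableEq W] (f : W → K.V)
    (bad arc : Finset W) : (K.reindex W f bad arc).arc = arc := rfl

end PMBaseKit

section Places

variable {F : Type u} {K : Type v} {Fbar : Type w} [Field F] [NumberField F] [Field K]
  [NumberField K] [Algebra F K] [Field Fbar] [Algebra F Fbar] [Algebra K Fbar]
  {E : WeierstrassCurve F} [E.IsElliptic] {l : ℕ} {P : BadPlacePredicates K}
  (D : InitialThetaData F K Fbar E l P)

namespace InitialThetaData

/-! ### Admissible truncations (RULING D13; L5-lead 22:11:48Z: `S` fibre-complete) -/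

/-- **IUTchI:Def3.1(e)** (kurims p.62) An ADMISSIBLE TRUNCATION of the place index: a finite set `S ⊆ V_mod` of
indices that contains `V^bad_mod` ("a nonempty set of nonarchimedean valuations of `F_mod`", Def 3.1 (b)), every
archimedean valuation, and, with an index, its whole fibre over `V(ℚ)` (so that the packets
`⊗_{v | v_ℚ}` of [IUTchIII] Prop 3.1 / Rmk 3.1.1 (iv) see complete fibres). The truncations over which
RULING D13 reads `[Fintype V]`-indexed decls. Merge-canon notion, not print. [claim: Mochizuki2012, status: disputed] -/
@[mk_iff]
structure IsAdmissibleTruncation (S : Finset (Val (fieldOfModuli E))) : Prop where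
  /-- `V^bad_mod ⊆ S` -/
  bad_subset : Val.non '' D.VbadMod ⊆ (S : Set (Val (fieldOfModuli E)))
  /-- every archimedean valuation of `F_mod` lies in `S` -/
  arc_mem : ∀ v : Val (fieldOfModuli E), v.IsArc → v ∈ S
  /-- `S` is a union of fibres of `V_mod ↠ V(ℚ)` -/
  fibre_complete : ∀ v w : Val (fieldOfModuli E), Val.restrict ℚ v = Val.restrict ℚ w → v ∈ S → w ∈ S

/-- **IUTchI:Def3.1(e)** (kurims p.62) For an admissible truncation, `V̲^bad ⊆ V̲_S`. [claim: Mochizuki2012, status: disputed] -/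
theorem Vbad_subset_VOver {S : Finset (Val (fieldOfModuli E))} (hS : D.IsAdmissibleTruncation S) :
    D.Vbad ⊆ D.VOver (S : Set (Val (fieldOfModuli E))) :=
  fun _ hw => ⟨hw.1, hS.bad_subset hw.2⟩

/-- **IUTchI:Def3.1(e)** (kurims p.62) For an admissible truncation, `V̲^arc ⊆ V̲_S` (restriction of valuations preserves
the archimedean type: an archimedean `w ∈ V̲` lies over an archimedean `v ∈ V_mod`). [claim: Mochizuki2012, status: disputed] -/
theorem Varc_subset_VOver {S : Finset (Val (fieldOfModuli E))} (hS : D.IsAdmissibleTruncation S) :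
    D.Varc ⊆ D.VOver (S : Set (Val (fieldOfModuli E))) := by
  rintro w ⟨hw, harc⟩
  refine ⟨hw, hS.arc_mem _ ?_⟩
  rcases w with w | w
  · exact rfl
  · exact absurd harc (by simp [Val.IsArc])

/-! ### The truncated kit bridge (C9-d / D13 (α)) -/

/-- **IUTchI:Def6.1** (kurims p.156) **The truncated place-kit bridge at `S`** — RECORDED WEAKENING (historical since B11,
p414335; un-truncated version: abc-iut-L5-t4's `InitialThetaData.PlaceKit`): the former field `PMBaseKit.fintypeV` forced
truncation to finite `S`; print's `V̲` is infinite (`isEmpty_fintype_V`, p408766).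
A `TruncatedKit D S` is abc-iut-L5-t4's [IUTchI] §6 base kit `PMBaseKit l` WHOSE INDEX SET IS `V̲_S`: an
identification `kit.V ≃ V̲_S` under which `kit.bad` is `V̲^bad ∩ V̲_S` and `kit.arc` is `V̲^arc ∩ V̲_S` (for
admissible `S`: all of `V̲^bad`, `V̲^arc`). HYPOTHESIS STRUCTURE (the real kit — `ℬ^temp(X_v)⁰`, `ℬ(X→_v)⁰`, the
Aut-holomorphic orbispaces, [IUTchI] Examples 3.2–3.4 / Def 4.1 (i) / 6.1 (ii) — is the L3/L4/L5 merge, not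
built here); every L5/L6/c312 decl over a `PMBaseKit` specialises along `T.kit` to "the initial Θ-data `D`
truncated to `S`". [claim: Mochizuki2012, status: disputed] -/
structure TruncatedKit (S : Finset (Val (fieldOfModuli E))) : Type (max uK v + 1) where
  /-- the kit ([IUTchI] Def 6.1 interface of abc-iut-L5-t4) -/
  kit : PMBaseKit.{uK} l
  /-- its index set IS the truncation `V̲_S` -/
  e : kit.V ≃ ↥(D.VOver (S : Set (Val (fieldOfModuli E))))
  /-- `kit.bad` corresponds to `V̲^bad` ([IUTchI] Def 3.1 (e), via the bad places of (b)) -/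
  mem_bad_iff : ∀ x : kit.V, x ∈ kit.bad ↔ ((e x : Val K) ∈ D.Vbad)
  /-- `kit.arc` corresponds to `V̲^arc` -/
  mem_arc_iff : ∀ x : kit.V, x ∈ kit.arc ↔ ((e x : Val K) ∈ D.Varc)

namespace TruncatedKit

variable {D}
variable {S S' : Finset (Val (fieldOfModuli E))}

/-- **IUTchI:Def3.1(e)** (kurims p.62) The valuation `v̲ ∈ V̲ ⊆ V(K)` indexed by an element of a truncated kit.
[claim: Mochizuki2012, status: disputed] -/
def val (T : D.TruncatedKit S) (x : T.kit.V) : Val K := (T.e x : Val K)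

/-- **IUTchI:Def3.1(e)** (kurims p.62) Indices of a truncated kit are valuations in `V̲`. [claim: Mochizuki2012, status: disputed] -/
theorem val_mem_V (T : D.TruncatedKit S) (x : T.kit.V) : T.val x ∈ D.V := (T.e x).2.1

/-- **IUTchI:Def3.1(e)** (kurims p.62) … lying over `S`. [claim: Mochizuki2012, status: disputed] -/
theorem toVMod_val_mem (T : D.TruncatedKit S) (x : T.kit.V) : toVMod F K E (T.val x) ∈ S := (T.e x).2.2

/-- **IUTchI:Def3.1(e)** (kurims p.62) `val` is injective (the index set is `V̲_S` itself). [claim: Mochizuki2012, status: disputed] -/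
theorem val_injective (T : D.TruncatedKit S) : Function.Injective T.val :=
  fun _ _ h => T.e.injective (Subtype.ext h)

/-- **IUTchI:Def3.1(e)** (kurims p.62) For an ADMISSIBLE truncation the kit's bad indices are in bijection with all of
`V̲^bad` (nothing bad is truncated away). [claim: Mochizuki2012, status: disputed] -/
theorem val_image_bad (T : D.TruncatedKit S) (hS : D.IsAdmissibleTruncation S) :
    T.val '' (T.kit.bad : Set T.kit.V) = D.Vbad := by
  ext w
  constructor
  · rintro ⟨x, hx, rfl⟩
    exact (T.mem_bad_iff x).1 hx
  · intro hw
    obtain ⟨y, hy⟩ := T.e.surjective ⟨w, D.Vbad_subset_VOver hS hw⟩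
    refine ⟨y, (T.mem_bad_iff y).2 ?_, ?_⟩
    · rw [hy]; exact hw
    · change ((T.e y : D.VOver _) : Val K) = w
      rw [hy]

/-- **IUTchI:Def3.1(e)** (kurims p.62) Likewise the kit's archimedean indices are all of `V̲^arc`. [claim: Mochizuki2012, status: disputed] -/
theorem val_image_arc (T : D.TruncatedKit S) (hS : D.IsAdmissibleTruncation S) :
    T.val '' (T.kit.arc : Set T.kit.V) = D.Varc := by
  ext w
  constructor
  · rintro ⟨x, hx, rfl⟩
    exact (T.mem_arc_iff x).1 hx
  · intro hw
    obtain ⟨y, hy⟩ := T.e.surjective ⟨w, D.Varc_subset_VOver hS hw⟩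
    refine ⟨y, (T.mem_arc_iff y).2 ?_, ?_⟩
    · rw [hy]; exact hw
    · change ((T.e y : D.VOver _) : Val K) = w
      rw [hy]

/-- **IUTchI:Def3.1(b)** (kurims p.61) For an admissible truncation the kit has a bad index ("`V^bad_mod` … nonempty").
[claim: Mochizuki2012, status: disputed] -/
theorem bad_nonempty (T : D.TruncatedKit S) (hS : D.IsAdmissibleTruncation S) : T.kit.bad.Nonempty := by
  obtain ⟨w, hw⟩ := D.Vbad_nonempty
  rw [← T.val_image_bad hS] at hw
  obtain ⟨x, hx, -⟩ := hw
  exact ⟨x, hx⟩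

/-! ### Restriction along `S ⊆ S′` -/

/-- **IUTchI:Def6.1** (kurims p.156) **Restriction law** of truncated kits along `S ⊆ S′`: the kit at `S` embeds into
the kit at `S′` OVER `V̲` (same valuations), with the ambient categories and the models at corresponding indices
identified (an equivalence of categories carrying `𝒟_v` to `𝒟_v`). Bad/archimedean indices then correspond
automatically (`Restriction.mem_bad_iff`). [claim: Mochizuki2012, status: disputed] -/
structure Restriction (T : D.TruncatedKit S) (T' : D.TruncatedKit S') where
  /-- the index embedding -/
  res : T.kit.V ↪ T'.kit.V
  /-- … over `V̲`: the same valuation -/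
  val_res : ∀ x, T'.val (res x) = T.val x
  /-- the ambient categories at corresponding indices are identified … -/
  ambEquiv : ∀ x, T.kit.Amb x ≌ T'.kit.Amb (res x)
  /-- … carrying the model `𝒟_v` to the model -/
  ambEquiv_model : ∀ x, (ambEquiv x).functor.obj (T.kit.model x) ≅ T'.kit.model (res x)

/-- **IUTchI:Def3.1(e)** (kurims p.62) A restriction exists only along `S ⊆ S′` at the level of valuations: the image
of a restricted index lies over `S′` and over `S`. [claim: Mochizuki2012, status: disputed] -/
theorem Restriction.toVMod_val_res_mem {T : D.TruncatedKit S} {T' : D.TruncatedKit S'} (r : Restriction T T')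
    (x : T.kit.V) : toVMod F K E (T'.val (r.res x)) ∈ S := by
  rw [r.val_res]; exact T.toVMod_val_mem x

/-- **IUTchI:Def3.1(e)** (kurims p.62) Under a restriction, bad indices correspond. [claim: Mochizuki2012, status: disputed] -/
theorem Restriction.mem_bad_iff {T : D.TruncatedKit S} {T' : D.TruncatedKit S'} (r : Restriction T T')
    (x : T.kit.V) : r.res x ∈ T'.kit.bad ↔ x ∈ T.kit.bad := by
  rw [T'.mem_bad_iff, T.mem_bad_iff]
  change T'.val (r.res x) ∈ D.Vbad ↔ T.val x ∈ D.Vbad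
  rw [r.val_res]

/-- **IUTchI:Def3.1(e)** (kurims p.62) Under a restriction, archimedean indices correspond. [claim: Mochizuki2012, status: disputed] -/
theorem Restriction.mem_arc_iff {T : D.TruncatedKit S} {T' : D.TruncatedKit S'} (r : Restriction T T')
    (x : T.kit.V) : r.res x ∈ T'.kit.arc ↔ x ∈ T.kit.arc := by
  rw [T'.mem_arc_iff, T.mem_arc_iff]
  change T'.val (r.res x) ∈ D.Varc ↔ T.val x ∈ D.Varc
  rw [r.val_res]

/-! ### KIT-RULE non-vacuity: truncated kits over the toy kit -/

open scoped Classical in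
/-- **IUTchI:Def6.1** (kurims p.156) **Non-vacuity.** For EVERY initial Θ-data `D` and EVERY finite `S ⊆ V_mod`, the toy kit of
abc-iut-L5-t4 (`PMBaseKit.toyKit`, one valuation) re-indexed by (a `Fin`-enumeration of) `V̲_S` with
`bad := V̲^bad ∩ V̲_S`, `arc := V̲^arc ∩ V̲_S` is a truncated kit at `S`: the hypothesis structure is inhabited (so decls
over it are not vacuously true), without any claim that this inhabitant is print's kit. (`l` prime `≥ 5` by
Def 3.1 (c).) UNIVERSE NOTE (merge fact): `PMBaseKit.V : Type` lives in `Type 0` while `V̲_S ⊆ Val K : Type v`; the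
bridge's `e` is an `Equiv` across universes, and a kit is indexed by a `Type 0` copy (`Fin #V̲_S` here; `Shrink ↥D.V` in
abc-iut-L5-t4's un-truncated `PlaceKit.toy` since B11). [claim: Mochizuki2012, status: disputed] -/
noncomputable def toy (D : InitialThetaData F K Fbar E l P) (S : Finset (Val (fieldOfModuli E))) :
    TruncatedKit.{0} D S :=
  haveI : Fact l.Prime := ⟨D.l_prime⟩
  have hl : l ≠ 2 := by have := D.five_le_l; omega
  let W : Set (Val K) := D.VOver (S : Set (Val (fieldOfModuli E)))
  let ε : Fin (Fintype.card ↥W) ≃ ↥W := (Fintype.equivFin ↥W).symm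
  { kit := (PMBaseKit.toyKit l hl).reindex (Fin (Fintype.card ↥W)) (fun _ => ())
      (Finset.univ.filter fun i => ((ε i : ↥W) : Val K) ∈ D.Vbad)
      (Finset.univ.filter fun i => ((ε i : ↥W) : Val K) ∈ D.Varc)
    e := ε
    mem_bad_iff := fun i =>
      (Finset.mem_filter (s := (Finset.univ : Finset (Fin (Fintype.card ↥W)))) (a := i)).trans
        (and_iff_right (Finset.mem_univ (α := Fin (Fintype.card ↥W)) i))
    mem_arc_iff := fun i =>
      (Finset.mem_filter (s := (Finset.univ : Finset (Fin (Fintype.card ↥W)))) (a := i)).trans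
        (and_iff_right (Finset.mem_univ (α := Fin (Fintype.card ↥W)) i)) }

/-- **IUTchI:Def3.1(e)** (kurims p.62) The toy truncated kit's index-to-valuation map is the chosen enumeration of `V̲_S`
followed by the inclusion `V̲_S ⊆ V(K)`. [claim: Mochizuki2012, status: disputed] -/
theorem toy_val (D : InitialThetaData F K Fbar E l P) (S : Finset (Val (fieldOfModuli E)))
    (i : (toy D S).kit.V) :
    (toy D S).val i = (((Fintype.equivFin ↥(D.VOver (S : Set (Val (fieldOfModuli E))))).symm i :
      ↥(D.VOver (S : Set (Val (fieldOfModuli E))))) : Val K) := rfl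

/-- **IUTchI:Def3.1(e)** (kurims p.62) `V̲_S ⊆ V̲_{S′}` for `S ⊆ S′`. [claim: Mochizuki2012, status: disputed] -/
theorem _root_.Literature.IUT.HodgeTheaters.InitialThetaData.VOver_mono {S₁ S₂ : Set (Val (fieldOfModuli E))}
    (h : S₁ ⊆ S₂) : D.VOver S₁ ⊆ D.VOver S₂ :=
  fun _ hw => ⟨hw.1, h hw.2⟩

/-- **IUTchI:Def6.1** (kurims p.156) **Non-vacuity of the restriction law**: along `S ⊆ S′` the toy truncated kits
restrict (index map = inclusion `V̲_S ↪ V̲_{S′}` read through the enumerations, identity equivalence of the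
constant ambient category, identity on the model). [claim: Mochizuki2012, status: disputed] -/
noncomputable def Restriction.toy (D : InitialThetaData F K Fbar E l P) {S S' : Finset (Val (fieldOfModuli E))}
    (h : S ⊆ S') : Restriction (TruncatedKit.toy D S) (TruncatedKit.toy D S') where
  res :=
    { toFun := fun i => (TruncatedKit.toy D S').e.symm
        ⟨(TruncatedKit.toy D S).val i, D.VOver_mono (Finset.coe_subset.2 h) ((TruncatedKit.toy D S).e i).2⟩
      inj' := fun i j hij => by
        have h1 := congrArg (fun k => (TruncatedKit.toy D S').val k) hij
        simp only [TruncatedKit.val, Equiv.apply_symm_apply] at h1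
        exact (TruncatedKit.toy D S).val_injective h1 }
  val_res i := by
    change (((TruncatedKit.toy D S').e ((TruncatedKit.toy D S').e.symm _) : ↥(D.VOver _)) : Val K) = _
    rw [Equiv.apply_symm_apply]
  ambEquiv _ := CategoryTheory.Equivalence.refl
  ambEquiv_model _ := Iso.refl _

end TruncatedKit

end InitialThetaData

end Places

end Literature.IUT.HodgeTheaters
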